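import Mathlib
import Summits.Ventures.PercRepro2.Defs
import Summits.Ventures.PercRepro2.Graph
import Summits.Ventures.PercRepro2.OneColourSwitch
import Summits.Ventures.PercRepro2.RegionHubSign
import Summits.Ventures.PercRepro2.SideSwitch
import Summits.Ventures.PercRepro2.TermSwitchDefs
import Summits.Ventures.PercRepro2.M9NoPocketDefs
import Summits.Ventures.PercRepro2.M9PsiOneDefs
import Summits.Ventures.PercRepro2.M9PsiOneWorlds
import Summits.Ventures.PercRepro2.M9PsiOneWorldsM

/-!
# The `Y`-world of `ω` survives in `Ψ₁ ω` outside `Fnl` (blind cell PercRepro2, p3 g31,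
2026-08-28; `proofs/P3-PAYMENT.md` §2, claim (i), second half)

The SURVIVAL SET `K₂(Ψ₁ ω) ∪ Fnl ∪ Mcore ∪ Outside` is closed under the open edges of `ω`
(`Sset_closed`): an open edge of `ω` into `d` or into a joined-or-linking vertex is kept, so it
carries the `Y`-world of `Ψ₁ ω` along.  Hence every `Y`-world vertex of `ω` outside `Fnl` lies
in the `Y`-world of `Ψ₁ ω` (`mem_K2_psiOne_of_mem_K2`), in particular `d ∈ K₂(Ψ₁ ω)`
(`mem_K2_psiOne`) and the joined `Y`-blocks and linking vertices do
(`mem_K2_psiOne_of_mem_union`).  With `M9PsiOneWorlds`: `Ψ₁ ω` is a one-sided `K`-point.  Own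
work; std axioms.
-/

namespace Summit.Ventures.PercRepro2

namespace NoPocket

open Finset Classical RegionHub OneColourSwitch SideSwitch TermSwitch

variable {V : Type*} {E : Type*}

section Survive

variable {ends : E → Sym2 V} {p q r s d : V} {ω : Config E}

variable (h : IsEX ends p q r s d ω)
include h

/-- The survival set: `K₂(Ψ₁ ω) ∪ Fnl ∪ Mcore ∪ Outside`. -/
def Sset (ends : E → Sym2 V) (r s d : V) (ω : Config E) : Set V :=
  {z | z ∈ K2 ends r s (psiOne ends r s d ω) ∨ z ∈ Fnl ends r s d ω ∨
    z ∈ Mcore ends r s d ω ∨ z ∈ Outside ends r s ω}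

omit h in
/-- A joined-or-linking vertex of the survival set is in `K₂(Ψ₁ ω)`. -/
lemma mem_K2_psiOne_of_mem_Sset_union (hD : DOne ends r s d ω) {x : V}
    (hx : x ∈ Sset ends r s d ω) (hxJ : x ∈ joinedY ends r s d ω ∪ linkSetY ends r s d ω) :
    x ∈ K2 ends r s (psiOne ends r s d ω) := by
  rcases hx with hx | hx | hx | hx
  · exact hx
  · exact (not_mem_union_of_mem_Fnl hx hxJ).elim
  · exact (not_mem_Mcore_of_mem_Kcore hD (mem_Kcore_of_mem_union hxJ) hx).elim
  · exact (hx.1 (mem_Kcore_of_mem_union hxJ).1).elim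

/-- `d` in the survival set is in `K₂(Ψ₁ ω)`. -/
lemma mem_K2_psiOne_of_mem_Sset_d (hx : d ∈ Sset ends r s d ω) :
    d ∈ K2 ends r s (psiOne ends r s d ω) := by
  rcases hx with hx | hx | hx | hx
  · exact hx
  · exact (d_not_mem_Kcore hx.1).elim
  · exact (d_not_mem_Mcore hx).elim
  · exact (hx.1 h.inK).elim

/-- **The survival set is closed under the open edges of `ω`.** -/
lemma Sset_closed :
    ∀ x ∈ Sset ends r s d ω, ∀ y, (openGraph ends ω).Adj x y → y ∈ Sset ends r s d ω := by
  intro x hx y hxy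
  obtain ⟨hne, e, he, hends⟩ := openGraph_adj.1 hxy
  rcases vertex_cases (ends := ends) (r := r) (s := s) (d := d) (ω := ω) y with
    hy | hy | hy | hyK | hyM | hyO
  · exact Or.inl (hy ▸ r_mem_K2 _)
  · exact Or.inl (hy ▸ s_mem_K2 _)
  · -- `y = d`: `x` is a joined `Y`-core vertex in `K₂(Ψ₁ ω)`; the kept open edge carries `d`
    left
    rw [hy] at hends ⊢
    rcases vertex_cases (ends := ends) (r := r) (s := s) (d := d) (ω := ω) x with
      hx' | hx' | hx' | hxK | hxM | hxO
    · exact (no_edge_d_term h (Or.inl hx') (ends_swap hends)).elim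
    · exact (no_edge_d_term h (Or.inr hx') (ends_swap hends)).elim
    · exact (hne (hx'.trans hy.symm)).elim
    · have hxJ : x ∈ joinedY ends r s d ω := mem_joinedY_of_adj_d hxK hends
      have hxK' := mem_K2_psiOne_of_mem_Sset_union h.done hx (Or.inl hxJ)
      have hk : e ∈ keptEdges ends r s d ω := mem_keptEdges_of_touches (Or.inl hxJ) hends
      exact mem_K2_of_open hxK' (by rw [psiOne_of_kept hk]; exact he) hends
    · rw [edge_Mcore_d h hxM hends] at he; exact (Bool.false_ne_true he).elim
    · exact (no_edge_d_out h hxO (ends_swap hends)).elim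
  · rcases Kcore_cases hyK with hyJ | hyF
    · left
      have hk : e ∈ keptEdges ends r s d ω := mem_keptEdges_of_touches hyJ (ends_swap hends)
      have he' : psiOne ends r s d ω e = true := by rw [psiOne_of_kept hk]; exact he
      rcases vertex_cases (ends := ends) (r := r) (s := s) (d := d) (ω := ω) x with
        hx' | hx' | hx' | hxK | hxM | hxO
      · exact mem_K2_of_open (hx' ▸ r_mem_K2 _) he' hends
      · exact mem_K2_of_open (hx' ▸ s_mem_K2 _) he' hends
      · rw [hx'] at hx hends
        exact mem_K2_of_open (mem_K2_psiOne_of_mem_Sset_d h hx) he' hends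
      · have hxJ : x ∈ joinedY ends r s d ω ∪ linkSetY ends r s d ω :=
          mem_union_of_edge hyJ hxK (ends_swap hends)
        exact mem_K2_of_open (mem_K2_psiOne_of_mem_Sset_union h.done hx hxJ) he' hends
      · exact (no_edge_core_core h hyK hxM (ends_swap hends)).elim
      · rw [edge_Kcore_out hyK hxO (ends_swap hends)] at he; exact (Bool.false_ne_true he).elim
    · exact Or.inr (Or.inl hyF)
  · exact Or.inr (Or.inr (Or.inl hyM))
  · exact Or.inr (Or.inr (Or.inr hyO))

/-- **A `Y`-world vertex of `ω` outside `Fnl` is in the `Y`-world of `Ψ₁ ω`.** -/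
theorem mem_K2_psiOne_of_mem_K2 {x : V} (hx : x ∈ K2 ends r s ω) (hxF : x ∉ Fnl ends r s d ω) :
    x ∈ K2 ends r s (psiOne ends r s d ω) := by
  have hx' : x ∈ Sset ends r s d ω := by
    rcases mem_K2_iff.1 hx with hc | hc
    · exact mem_of_conn_of_closed (Sset_closed h) (Or.inl (r_mem_K2 _)) hc
    · exact mem_of_conn_of_closed (Sset_closed h) (Or.inl (s_mem_K2 _)) hc
  rcases hx' with hx' | hx' | hx' | hx'
  · exact hx'
  · exact (hxF hx').elim
  · exact (not_mem_K2_of_mem_Mcore h.done hx' hx).elim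
  · exact (hx'.1 hx).elim

/-- **`d ∈ K₂(Ψ₁ ω)`.** -/
theorem mem_K2_psiOne : d ∈ K2 ends r s (psiOne ends r s d ω) :=
  mem_K2_psiOne_of_mem_K2 h h.inK (fun hd => d_not_mem_Kcore hd.1)

/-- The joined `Y`-blocks and the linking vertices lie in the `Y`-world of `Ψ₁ ω`. -/
theorem mem_K2_psiOne_of_mem_union {x : V}
    (hx : x ∈ joinedY ends r s d ω ∪ linkSetY ends r s d ω) :
    x ∈ K2 ends r s (psiOne ends r s d ω) :=
  mem_K2_psiOne_of_mem_K2 h (mem_Kcore_of_mem_union hx).1 (fun hF => not_mem_union_of_mem_Fnl hF hx)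

end Survive

end NoPocket

end Summit.Ventures.PercRepro2
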